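import Mathlib
import Literature.Computability.Complexity.FixedDimILPPrograms
import Literature.Computability.Complexity.FixedDimILPPolytope
import HarnessLib

/-!
# Lenstra's algorithm in fixed dimension, VIII: the vertex list is correct

Topic `Computability/Complexity`, grouping namespace `FixedDimILP`. Correctness of step 2 of the list
program of `FixedDimILPPrograms.lean`: for rows of the right shape, `verticesL N rows'` lists rational
points `p/d` (`d > 0`) of the polyhedron `poly (realSysL N rows')`, and EVERY basic point of that polyhedron
(file I: `N` tight rows with nonsingular matrix; every vertex is one) is listed — so, by file I, a bounded
`poly (realSysL N rows')` is the convex hull of the listed points.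

* reading lists in `ℝ^N`: `realRow`, `realSysL`, `ptOf`, `Shaped`; `mem_tuplesL_iff`; `dotZ_ofFn_getD`;
* the square system of a tuple: `matOf`, `rhsOf`, `coefMat_eq_rowsOf`, `detZ_coefMat`, `solveNum_eq`;
* `verticesL_spec` (what is listed: from a tuple with `detZ ≠ 0`, feasible), `pos_of_mem_verticesL`,
  `ptOf_mem_poly_of_mem_verticesL`, `length_of_mem_verticesL`;
* **`exists_mem_verticesL_of_isBasicPoint`** — every basic point in the polyhedron is `ptOf v` for a
  listed `v`; hence **`poly_realSysL_eq_convexHull`** for bounded polyhedra (with file I).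

## References

* A. Schrijver, *Theory of Linear and Integer Programming*, Wiley 1986, Thm. 8.4, §8.5 (vertices are basic
  feasible solutions; enumerating them by subsystems). [Schrijver1986]
* H. W. Lenstra, Jr., Math. Oper. Res. 8 (1983), §2 remark (b), p. 545 (for fixed `n` brute force over the
  vertices suffices). [LenstraHW1983]
* H. Cohen, GTM 138, §2.6.3 (exact solution of square integer systems, `T⁻¹ = invMatrix T / det²`). [Cohen1993]
-/

namespace Literature.Computability.Complexity

namespace FixedDimILP

open Matrix Finset Literature.Algebra.EuclideanLattices Literature.Algebra.EuclideanLattices.GSInverse IntDetFP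

variable {N : ℕ}

/-! ### Tuples -/

/-- Membership in `tuplesL k l`: the lists of length `k` with entries in `l`. [folklore] -/
theorem mem_tuplesL_iff {α : Type} {k : ℕ} {l t : List α} : t ∈ tuplesL k l ↔ t.length = k ∧ ∀ a ∈ t, a ∈ l := by
  induction k generalizing t with
  | zero =>
    simp only [tuplesL, List.mem_singleton, List.length_eq_zero_iff]
    constructor
    · rintro rfl; simp
    · rintro ⟨rfl, -⟩; rfl
  | succ k ih =>
    simp only [tuplesL, List.mem_flatten, List.mem_map]
    constructor
    · rintro ⟨_, ⟨a, ha, rfl⟩, ht⟩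
      obtain ⟨t', ht', rfl⟩ := List.mem_map.1 ht
      obtain ⟨hlen, hmem⟩ := ih.1 ht'
      exact ⟨by simp [hlen], fun b hb => by
        rcases List.mem_cons.1 hb with rfl | hb
        · exact ha
        · exact hmem b hb⟩
    · rintro ⟨hlen, hmem⟩
      cases t with
      | nil => simp at hlen
      | cons a t' =>
        refine ⟨_, ⟨a, hmem a List.mem_cons_self, rfl⟩, List.mem_map.2 ⟨t', ih.2 ⟨by simpa using hlen, fun b hb =>
          hmem b (List.mem_cons_of_mem _ hb)⟩, rfl⟩⟩

/-- `List.ofFn f ∈ tuplesL k l` when all values lie in `l`. [folklore] -/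
theorem ofFn_mem_tuplesL {α : Type} {k : ℕ} {l : List α} (f : Fin k → α) (hf : ∀ i, f i ∈ l) :
    List.ofFn f ∈ tuplesL k l :=
  mem_tuplesL_iff.2 ⟨List.length_ofFn, fun a ha => by
    obtain ⟨i, rfl⟩ := (List.mem_ofFn' f a).1 ha
    exact hf i⟩

/-! ### Reading lists in `ℝ^N` -/

/-- A list row read as a real row in `ℝ^N` (entries past the end are `0`). [folklore] -/
noncomputable def realRow (N : ℕ) (r : LRow) : (Fin N → ℝ) × ℝ := (fun j => (r.1.getD j 0 : ℝ), (r.2 : ℝ))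

/-- A list system read as a real system. [folklore] -/
noncomputable def realSysL (N : ℕ) (rows : List LRow) : RealSys N := rows.map (realRow N)

/-- Membership in the polyhedron of a list system. [folklore] -/
theorem mem_poly_realSysL_iff (rows : List LRow) (x : Fin N → ℝ) :
    x ∈ poly (realSysL N rows) ↔ ∀ r ∈ rows, (realRow N r).1 ⬝ᵥ x ≤ (r.2 : ℝ) := by
  rw [mem_poly, realSysL, List.forall_mem_map]; rfl

/-- The real point `p / d` of a list vertex. [folklore] -/
noncomputable def ptOf (N : ℕ) (v : LVert) : Fin N → ℝ := fun j => (v.1.getD j 0 : ℝ) / v.2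

/-- Rows of coefficient length exactly `N`. [folklore] -/
def Shaped (N : ℕ) (rows : List LRow) : Prop := ∀ r ∈ rows, r.1.length = N

/-- The truncating dot product against a row of length `N` is the sum over `Fin N`. [folklore] -/
theorem dotZ_eq_sum_getD {a : List ℤ} (ha : a.length = N) (x : List ℤ) (hx : x.length ≤ N) :
    dotZ a x = ∑ j : Fin N, a.getD j 0 * x.getD j 0 :=
  dotZ_eq_sum a x ha.le hx

/-- The dot product with `List.ofFn`. [folklore] -/
theorem dotZ_ofFn_right {a : List ℤ} (ha : a.length = N) (u : Fin N → ℤ) :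
    dotZ a (List.ofFn u) = ∑ j : Fin N, a.getD j 0 * u j := by
  rw [dotZ_eq_sum_getD ha _ (by simp)]
  refine Finset.sum_congr rfl fun j _ => ?_
  rw [List.getD_eq_getElem (List.ofFn u) _ (by simp), List.getElem_ofFn]

/-- The real row dotted with the real reading of an integer list is the cast of `dotZ`. [folklore] -/
theorem realRow_dotProduct_cast {r : LRow} (hr : r.1.length = N) (x : List ℤ) (hx : x.length ≤ N) :
    (realRow N r).1 ⬝ᵥ (fun j => (x.getD j 0 : ℝ)) = (dotZ r.1 x : ℝ) := by
  rw [dotZ_eq_sum_getD hr x hx]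
  push_cast
  rfl

/-! ### The square system of a tuple -/

/-- The coefficient matrix of a tuple of `N` rows. [folklore] -/
def matOf (N : ℕ) (S : List LRow) : Matrix (Fin N) (Fin N) ℤ := fun i j => (S.getD i ([], 0)).1.getD j 0

/-- The right-hand sides of a tuple of `N` rows. [folklore] -/
def rhsOf (N : ℕ) (S : List LRow) : Fin N → ℤ := fun i => (S.getD i ([], 0)).2

/-- For a tuple of `N` shaped rows, `coefMat` is the row list of `matOf`. [folklore] -/
theorem coefMat_eq_rowsOf {S : List LRow} (hS : S.length = N) (hsh : Shaped N S) : coefMat S = rowsOf (matOf N S) := by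
  refine List.ext_getElem (by simp [coefMat, hS]) fun i h₁ h₂ => ?_
  simp only [coefMat, List.getElem_map, rowsOf, List.getElem_ofFn]
  have hi : i < S.length := by simpa [coefMat] using h₁
  have hlen := hsh _ (List.getElem_mem hi)
  refine List.ext_getElem (by simp [hlen]) fun j hj₁ hj₂ => ?_
  simp only [List.getElem_ofFn, matOf, List.getD_eq_getElem _ _ hi]
  rw [List.getD_eq_getElem _ _ (by omega)]

/-- Hence `detZ (coefMat S) = det (matOf S)`. [cite: Berkowitz1984, §2] -/
theorem detZ_coefMat {S : List LRow} (hS : S.length = N) (hsh : Shaped N S) : detZ (coefMat S) = (matOf N S).det := by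
  rw [coefMat_eq_rowsOf hS hsh]
  exact detZ_rows (matOf N S)

/-- The right-hand-side list of a tuple. [folklore] -/
theorem map_snd_eq_ofFn_rhsOf {S : List LRow} (hS : S.length = N) : S.map Prod.snd = List.ofFn (rhsOf N S) := by
  refine List.ext_getElem (by simp [hS]) fun i h₁ h₂ => ?_
  simp only [List.getElem_map, List.getElem_ofFn, rhsOf]
  rw [List.getD_eq_getElem _ _ (by simpa using h₁)]

/-- **The exact solver computes `invMatrix (matOf S) *ᵥ rhsOf S`.** [cite: Cohen1993, §2.6.3] -/
theorem solveNum_eq {S : List LRow} (hS : S.length = N) (hsh : Shaped N S) :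
    solveNum S = List.ofFn (invMatrix (matOf N S) *ᵥ rhsOf N S) := by
  rw [solveNum, map_snd_eq_ofFn_rhsOf hS, hS, coefMat_eq_rowsOf hS hsh]
  refine List.ext_getElem (by simp) fun t h₁ h₂ => ?_
  simp only [List.getElem_map, List.getElem_range, List.getElem_ofFn, mulVec, dotProduct]
  have hcol : ((invCols (rowsOf (matOf N S))).map fun col => col.getD t 0) =
      List.ofFn fun k : Fin N => invMatrix (matOf N S) ⟨t, by simpa using h₁⟩ k := by
    refine List.ext_getElem (by simp) fun k hk₁ hk₂ => ?_
    simp only [List.getElem_map, List.getElem_ofFn, invMatrix_apply]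
    rw [getElem_invCols]
  rw [hcol, dotZ_ofFn_right (by simp)]
  refine Finset.sum_congr rfl fun k _ => ?_
  rw [List.getD_eq_getElem _ _ (by simp), List.getElem_ofFn]

/-- The denominator of a basic solution is `det²`. [cite: Cohen1993, §2.6.3] -/
theorem invDen_coefMat {S : List LRow} (hS : S.length = N) (hsh : Shaped N S) (hdet : (matOf N S).det ≠ 0) :
    invDen (coefMat S) = (matOf N S).det ^ 2 := by
  rw [coefMat_eq_rowsOf hS hsh, invDen_eq_det_sq hdet]

/-! ### What is listed -/

/-- Unfolding of membership in the vertex list. [folklore] -/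
theorem mem_verticesL_iff {rows' : List LRow} {v : LVert} :
    v ∈ verticesL N rows' ↔ ∃ S ∈ tuplesL N rows', detZ (coefMat S) ≠ 0 ∧ satV rows' (vertexOf S) = true ∧ vertexOf S = v := by
  simp only [verticesL, List.mem_map, List.mem_filter, Bool.and_eq_true, decide_eq_true_eq]
  constructor
  · rintro ⟨S, ⟨hS, h1, h2⟩, rfl⟩; exact ⟨S, hS, h1, h2, rfl⟩
  · rintro ⟨S, hS, h1, h2, rfl⟩; exact ⟨S, ⟨hS, h1, h2⟩, rfl⟩

/-- Listed vertices have denominator `det² > 0`. [folklore] -/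
theorem pos_of_mem_verticesL {rows' : List LRow} (hsh : Shaped N rows') {v : LVert} (hv : v ∈ verticesL N rows') :
    0 < v.2 := by
  obtain ⟨S, hS, hdet, -, rfl⟩ := mem_verticesL_iff.1 hv
  obtain ⟨hlen, hmem⟩ := mem_tuplesL_iff.1 hS
  have hshS : Shaped N S := fun r hr => hsh r (hmem r hr)
  rw [detZ_coefMat hlen hshS] at hdet
  change 0 < (invDen (coefMat S)).toNat
  rw [invDen_coefMat hlen hshS hdet]
  have : 0 < (matOf N S).det ^ 2 := by positivity
  omega

/-- Listed vertices have numerators of length `N`. [folklore] -/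
theorem length_of_mem_verticesL {rows' : List LRow} {v : LVert} (hv : v ∈ verticesL N rows') : v.1.length = N := by
  obtain ⟨S, hS, -, -, rfl⟩ := mem_verticesL_iff.1 hv
  simp [vertexOf, solveNum, (mem_tuplesL_iff.1 hS).1]

/-- `satV` read in `ℝ^N`: a rational point `p/d` (`d > 0`) satisfies the real system iff `a · p ≤ β d`
row by row. [folklore] -/
theorem satV_eq_true_iff {rows' : List LRow} (hsh : Shaped N rows') {v : LVert} (hd : 0 < v.2) (hv : v.1.length ≤ N) :
    satV rows' v = true ↔ ptOf N v ∈ poly (realSysL N rows') := by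
  rw [satV, List.all_eq_true, mem_poly_realSysL_iff]
  refine forall₂_congr fun r hr => ?_
  rw [decide_eq_true_eq]
  have hd' : (0 : ℝ) < v.2 := by exact_mod_cast hd
  have hdot : (realRow N r).1 ⬝ᵥ ptOf N v = ((realRow N r).1 ⬝ᵥ fun j => (v.1.getD j 0 : ℝ)) / v.2 := by
    simp only [dotProduct, ptOf, Finset.sum_div, mul_div_assoc]
  rw [hdot, realRow_dotProduct_cast (hsh r hr) v.1 hv, div_le_iff₀ hd']
  constructor
  · intro h; exact_mod_cast h
  · intro h; exact_mod_cast h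

/-- **Listed vertices lie in the polyhedron.** [cite: Schrijver1986, §8.5] -/
theorem ptOf_mem_poly_of_mem_verticesL {rows' : List LRow} (hsh : Shaped N rows') {v : LVert}
    (hv : v ∈ verticesL N rows') : ptOf N v ∈ poly (realSysL N rows') := by
  have hd := pos_of_mem_verticesL hsh hv
  have hl := length_of_mem_verticesL hv
  obtain ⟨S, -, -, hsat, rfl⟩ := mem_verticesL_iff.1 hv
  exact (satV_eq_true_iff hsh hd hl.le).1 hsat

/-! ### Everything basic is listed -/

/-- The cast of the quasi-inverse identity: `A · G = det² • 1` over `ℝ`, hence `G · A = det² • 1`.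
[cite: Cohen1993, §2.6.3] -/
theorem invMatrix_mul_cast {M : Matrix (Fin N) (Fin N) ℤ} (hdet : M.det ≠ 0) :
    (invMatrix M).map (Int.cast : ℤ → ℝ) * M.map (Int.cast : ℤ → ℝ) = ((M.det : ℝ) ^ 2) • 1 := by
  have hmul : M.map (Int.cast : ℤ → ℝ) * (invMatrix M).map (Int.cast : ℤ → ℝ) = ((M.det : ℝ) ^ 2) • 1 := by
    rw [show M.map (Int.cast : ℤ → ℝ) * (invMatrix M).map (Int.cast : ℤ → ℝ) = (M * invMatrix M).map (Int.cast : ℤ → ℝ)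
      from (Matrix.map_mul (f := Int.castRingHom ℝ)).symm, mul_invMatrix hdet]
    ext i j
    rw [Matrix.map_apply, Matrix.smul_apply, Matrix.smul_apply, Matrix.one_apply, Matrix.one_apply]
    split_ifs <;> simp
  have hc : ((M.det : ℝ) ^ 2) ≠ 0 := pow_ne_zero 2 (Int.cast_ne_zero.2 hdet)
  have hinv : M.map (Int.cast : ℤ → ℝ) * ((((M.det : ℝ) ^ 2)⁻¹) • (invMatrix M).map (Int.cast : ℤ → ℝ)) = 1 := by
    rw [Matrix.mul_smul, hmul, smul_smul, inv_mul_cancel₀ hc, one_smul]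
  have hinv' := mul_eq_one_comm.1 hinv
  rw [Matrix.smul_mul] at hinv'
  have := congrArg (fun X => ((M.det : ℝ) ^ 2) • X) hinv'
  simp only [smul_smul, mul_inv_cancel₀ hc, one_smul] at this
  exact this

/-- **Every basic point of the polyhedron is listed**: if `x ∈ poly (realSysL N rows')` is basic (file I)
then `x = ptOf v` for some `v ∈ verticesL N rows'`. [cite: Schrijver1986, Thm. 8.4 and §8.5] [cite: LenstraHW1983, §2 remark (b)] -/
theorem exists_mem_verticesL_of_isBasicPoint {rows' : List LRow} (hsh : Shaped N rows') {x : Fin N → ℝ}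
    (hx : x ∈ poly (realSysL N rows')) (hb : IsBasicPoint (realSysL N rows') x) :
    ∃ v ∈ verticesL N rows', ptOf N v = x := by
  obtain ⟨S', hS'mem, hdet', htight⟩ := hb
  -- the rows behind the basic subsystem
  have hrow : ∀ i, ∃ r ∈ rows', realRow N r = S' i := fun i => List.mem_map.1 (hS'mem i)
  choose r hr using hrow
  set T : List LRow := List.ofFn r with hT
  have hTmem : T ∈ tuplesL N rows' := ofFn_mem_tuplesL r fun i => (hr i).1
  have hTlen : T.length = N := List.length_ofFn
  have hTsh : Shaped N T := fun a ha => hsh a ((mem_tuplesL_iff.1 hTmem).2 a ha)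
  have hgetD : ∀ i : Fin N, T.getD i ([], 0) = r i := fun i => by
    rw [hT, List.getD_eq_getElem _ _ (by simp), List.getElem_ofFn]
  -- the integer matrix of `T` casts to the real matrix of the basic subsystem
  set M := matOf N T with hM
  have hcast : M.map (Int.cast : ℤ → ℝ) = Matrix.of fun i => (S' i).1 := by
    ext i j
    rw [Matrix.map_apply, hM, matOf, hgetD, Matrix.of_apply, ← (hr i).2]
    rfl
  have hdetM : M.det ≠ 0 := by
    intro h0
    apply hdet'
    rw [← hcast, show M.map (Int.cast : ℤ → ℝ) = (Int.castRingHom ℝ).mapMatrix M from rfl, ← RingHom.map_det, h0,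
      map_zero]
  -- `A x = b`
  have hAx : (M.map (Int.cast : ℤ → ℝ)) *ᵥ x = fun i => (rhsOf N T i : ℝ) := by
    funext i
    rw [hcast]
    change (S' i).1 ⬝ᵥ x = (rhsOf N T i : ℝ)
    rw [htight i, rhsOf, hgetD, ← (hr i).2]
    rfl
  -- the listed vertex of `T`: `ptOf (vertexOf T) = x`
  have hsol := solveNum_eq hTlen hTsh
  have hden : ((vertexOf T).2 : ℝ) = (M.det : ℝ) ^ 2 := by
    change (((invDen (coefMat T)).toNat : ℕ) : ℝ) = _
    rw [invDen_coefMat hTlen hTsh hdetM]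
    have h0 : 0 ≤ M.det ^ 2 := sq_nonneg _
    rw [show (((M.det ^ 2).toNat : ℕ) : ℝ) = ((M.det ^ 2 : ℤ) : ℝ) by exact_mod_cast Int.toNat_of_nonneg h0]
    push_cast; ring
  have hGA := invMatrix_mul_cast hdetM
  have hkey : (invMatrix M).map (Int.cast : ℤ → ℝ) *ᵥ (fun i => (rhsOf N T i : ℝ)) = ((M.det : ℝ) ^ 2) • x := by
    rw [← hAx, mulVec_mulVec, hGA, smul_mulVec, one_mulVec]
  have hpt : ptOf N (vertexOf T) = x := by
    funext j
    have hj := congrFun hkey j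
    simp only [mulVec, dotProduct, Matrix.map_apply, Pi.smul_apply, smul_eq_mul] at hj
    rw [ptOf, hden]
    change (((vertexOf T).1.getD j 0 : ℤ) : ℝ) / (M.det : ℝ) ^ 2 = x j
    rw [show (vertexOf T).1 = solveNum T from rfl, hsol, List.getD_eq_getElem _ _ (by simp), List.getElem_ofFn]
    simp only [mulVec, dotProduct, Int.cast_sum, Int.cast_mul]
    have hc : ((M.det : ℝ) ^ 2) ≠ 0 := pow_ne_zero 2 (Int.cast_ne_zero.2 hdetM)
    rw [hj, mul_div_assoc, mul_div_cancel₀ _ hc]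
  -- it passes the filter
  have hd : 0 < (vertexOf T).2 := by
    change 0 < (invDen (coefMat T)).toNat
    rw [invDen_coefMat hTlen hTsh hdetM]
    have : 0 < (matOf N T).det ^ 2 := by rw [← hM]; positivity
    omega
  have hl : (vertexOf T).1.length ≤ N := by simp [vertexOf, solveNum, hTlen]
  have hsat : satV rows' (vertexOf T) = true := (satV_eq_true_iff hsh hd hl).2 (hpt ▸ hx)
  have hdz : detZ (coefMat T) ≠ 0 := by rw [detZ_coefMat hTlen hTsh]; exact hdetM
  exact ⟨vertexOf T, mem_verticesL_iff.2 ⟨T, hTmem, hdz, hsat, rfl⟩, hpt⟩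

/-- **A bounded polyhedron of shaped list rows is the convex hull of its vertex list** (files I + VIII).
[cite: Schrijver1986, §8.4–8.5] -/
theorem poly_realSysL_eq_convexHull {rows' : List LRow} (hsh : Shaped N rows')
    (hb : Bornology.IsBounded (poly (realSysL N rows'))) :
    poly (realSysL N rows') = convexHull ℝ ((verticesL N rows').map (ptOf N)).toFinset := by
  apply Set.Subset.antisymm
  · refine poly_subset_convexHull hb (List.toFinset _).finite_toSet fun x hx hbx => ?_
    obtain ⟨v, hv, rfl⟩ := exists_mem_verticesL_of_isBasicPoint hsh hx hbx
    simp only [List.coe_toFinset, Set.mem_setOf_eq, List.mem_map]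
    exact ⟨v, hv, rfl⟩
  · refine convexHull_subset_poly fun y hy => ?_
    simp only [List.coe_toFinset, Set.mem_setOf_eq, List.mem_map] at hy
    obtain ⟨v, hv, rfl⟩ := hy
    exact ptOf_mem_poly_of_mem_verticesL hsh hv

end FixedDimILP

end Literature.Computability.Complexity
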